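import Summits.HubbardSuperconductivity.HubbardSuperconductivity.Theorems.JosephsonMirrorJmInterchangeExactResidues
import Literature.MathematicalPhysics.QuantumLattice.PairFieldSelectionRule

/-!
# Negative lemma for `JosephsonMirror.JmInterchange` (stmt-HubbardSuperconductivity-2227) modulo `ZepoFloorMismatch`

Crux `JmInterchange` (rank 2 of route `JosephsonMirror`, universally quantified in `(U, δ)`): uniform linear Josephson
gain of the window double (onset `L₀ = L₀(J)`) ⇒ eventually in even `L` some unit ground-floor pair `φ ∈ G(N_L, 0)`,
`χ ∈ G(N_L − 2, 0)` of `hubbardTorus 2 L 1 U` with `a' L⁴ ≤ |⟨χ, Δ_d φ⟩|²` (`Δ_d = pairField dWaveFormFactor L`).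
By the tree's normal form (`jmInterchange_iff_singleLayerForm`, p106153/p110212) its hypothesis is, point by point,
ZERO-EXCESS `d`-WAVE PAIR ORDER; by `jmInterchange_iff_reachesFloor_and_bridges` (p127245) the crux is
`∀ (U, δ)`: (R1) zero-excess order reaches the floor ∧ (R2′) floor order bridges to the adjacent floor.

This file types the route's own kill criterion (a) ("a `(U, δ)` with uniform linear Josephson gain but no ground-floor
`Δ_d`-bridge for infinitely many even `L`: selection-rule mismatch between `G(N_L)` and `G(N_L − 2)`") as a Lean
implication, for THIS crux:

* `ZepoFloorMismatch` (HYPOTHESIS H, not constructible in the tree today): some `U > 0`, `δ ∈ (0, 1/2)` carry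
  zero-excess `d`-wave pair order AND, for infinitely many even `L`, a space-group element `g = (γ, v)` of the square
  torus under which the whole `(N_L, 0)` floor is isotypic with character `lam` and the whole `(N_L − 2, 0)` floor is
  isotypic with character `mu ≠ χ_{B₁g}(γ) · lam` (momentum mismatch for `γ = 1`; `C₄`-character mismatch — the
  non-alternating cat parities of a `C₄`-breaking paired phase, since `U_R Δ_d U_R⁻¹ = −Δ_d` — for `v = 0`);
* `JmInterchange_false_of_ZepoFloorMismatch : ZepoFloorMismatch → ¬ JmInterchange`: the crux in single-layer form
  turns the zero-excess order at `(U, δ)` into a floor pair `(φ, χ)` with `a' L⁴ ≤ |⟨χ, Δ_d φ⟩|²` at every large even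
  `L`; at the mismatched `L` the selection rule for the `d_{x²-y²}` pair field
  (`Literature.….pairField_dWave_matrixElement_eq_zero`: `U_g Δ_d = χ_{B₁g}(γ) Δ_d U_g`) gives `⟨χ, Δ_d φ⟩ = 0`,
  contradicting `a' L⁴ > 0`;
* `JmInterchange_false_of_floorOrder_of_floorMismatch`: the same with FLOOR ORDER of `(N_L, 0)` in place of zero-excess
  order (a ground state has zero excess, `zeroExcessPairOrder_of_floorOrder`) — "an ordered `d`-wave floor whose
  adjacent floor has the wrong quantum numbers infinitely often" refutes the crux (the (R2′)-type failure, Adv₂).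

Why H is not constructible here: its first conjunct is certified `d`-wave pair order at vanishing excess energy DENSITY
of the doped repulsive two-dimensional Hubbard torus at an explicit `(U, δ)` — the summit's own thermodynamic content
(barriers `WeakCouplingCeiling`, `StrongCouplingCeiling`, `PerturbativeInvisibilityOfPairing`); its second asks for the
exact space-group quantum numbers of two adjacent ground floors for infinitely many `L` (no sign structure or spatial
reflection positivity off half filling; exact diagonalisation reaches `L ≤ 4`, where the ED census of this crux,
`Cruxes/JmInterchange/NegativeNotesIdeator2.md` BN4, does find the bridge `σ_max(P_{G(N−2)} Δ_d P_{G(N)})² = 0`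
exactly on the `√8`, `√10`, `4×4` tori at `U ∈ {2, 4, 8}`).  The lemma records precisely what a refutation of the
`∀ (U, δ)` crux by quantum numbers must establish; it does not bear on (R1).

Sources: D. J. Scalapino, Phys. Rep. 250 (1995) 329, §2 (`Δ_d ∈ B₁g`); T. Koma, H. Tasaki, J. Stat. Phys. 76 (1994) 745;
H. Tasaki, J. Stat. Phys. 174 (2019) 735 §5.  Pure finite-dimensional linear algebra over landed theorems.
-/

noncomputable section

namespace Summit.HubbardSuperconductivity.JmInterchangeNegative

open Matrix Literature.MathematicalPhysics.QuantumLattice Literature.Probability.LatticeModels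
open Summit.HubbardSuperconductivity.HubbardSuperconductivity.Theses.JosephsonMirror (JmInterchange)
open Summit.HubbardSuperconductivity.HubbardSuperconductivity.Theorems.JosephsonMirror

/-- HYPOTHESIS H — **zero-excess pair order at a point whose adjacent floors mismatch in symmetry infinitely often**
(NOT constructible in the tree today).  Some `U > 0`, `δ ∈ (0, 1/2)` such that
(i) ZERO-EXCESS `d`-WAVE PAIR ORDER holds at `(U, δ)` — for some `c > 0` and every `ε > 0`, eventually in even `L`, a
unit vector of sector `N_L` or `N_L − 2` (`S^z = 0`, `N_L = 2⌊(1 − δ)L²/2⌋`) of `hubbardTorus 2 L 1 U` lies within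
`εL²` of its sector floor and has `‖Δ_d v‖² ≥ cL⁴` (the single-layer equivalent of the crux's gain hypothesis); and
(ii) FLOOR MISMATCH INFINITELY OFTEN — for every `L₀` there are an even `L ≥ L₀`, a space-group element `g = (γ, v)`
realised by `U_g = fockD4 γ * fockTranslate v`, and characters `lam`, `mu` with every ground state of `(N_L, 0)` a
`U_g`-eigenvector of eigenvalue `lam`, every ground state of `(N_L − 2, 0)` a `U_g`-eigenvector of eigenvalue `mu`,
and `mu ≠ χ_{B₁g}(γ) · lam`. [topic: MathematicalPhysics/QuantumLattice] -/
def ZepoFloorMismatch : Prop :=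
  ∃ U : ℝ, 0 < U ∧ ∃ δ ∈ Set.Ioo (0 : ℝ) (1 / 2),
    (∃ c : ℝ, 0 < c ∧ ∀ ε : ℝ, 0 < ε → ∃ L₀ : ℕ, ∀ (L : ℕ) [NeZero L], Even L → L₀ ≤ L →
      ∃ n : ℕ, (n = (2 * ⌊(1 - δ) * (L : ℝ) ^ 2 / 2⌋₊) ∨ n = (2 * ⌊(1 - δ) * (L : ℝ) ^ 2 / 2⌋₊) - 2) ∧
        ∃ v : Fock (Orb (FermionTorus 2 L)), v ∈ szSector n 0 ∧ star v ⬝ᵥ v = 1 ∧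
          (star v ⬝ᵥ (hubbardTorus 2 L 1 U *ᵥ v)).re ≤
              (hubbardTorus 2 L 1 U).minEnergyOn (szSector n 0) + ε * (L : ℝ) ^ 2 ∧
          c * (L : ℝ) ^ 4 ≤
            (star (pairField dWaveFormFactor L *ᵥ v) ⬝ᵥ (pairField dWaveFormFactor L *ᵥ v)).re) ∧
    (∀ L₀ : ℕ, ∃ (L : ℕ) (_ : NeZero L), Even L ∧ L₀ ≤ L ∧
      ∃ (γ : DihedralGroup 4) (v : TorusSite 2 L) (lam mu : ℂ),
        (∀ φ : Fock (Orb (FermionTorus 2 L)),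
          IsGroundStateInSector (hubbardTorus 2 L 1 U) (2 * ⌊(1 - δ) * (L : ℝ) ^ 2 / 2⌋₊) 0 φ →
            ((fockD4 (L := L) γ).val * (fockTranslate v).val) *ᵥ φ = lam • φ) ∧
        (∀ χ : Fock (Orb (FermionTorus 2 L)),
          IsGroundStateInSector (hubbardTorus 2 L 1 U) (2 * ⌊(1 - δ) * (L : ℝ) ^ 2 / 2⌋₊ - 2) 0 χ →
            ((fockD4 (L := L) γ).val * (fockTranslate v).val) *ᵥ χ = mu • χ) ∧
        mu ≠ b1gChar γ * lam)

/-- **Selection rule at a mismatched volume.**  If at side `L` every ground state of `(N, 0)` is a `U_g`-eigenvector of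
eigenvalue `lam`, every ground state of `(N − 2, 0)` one of eigenvalue `mu`, and `mu ≠ χ_{B₁g}(γ) lam`, then NO unit
ground-floor pair reaches `a' L⁴` for any `a' > 0`: `⟨χ, Δ_d φ⟩ = 0` by `pairField_dWave_matrixElement_eq_zero`.
[folklore] -/
theorem no_floorPair_of_mismatch {L : ℕ} [NeZero L] (U : ℝ) (N : ℕ) (γ : DihedralGroup 4) (v : TorusSite 2 L)
    (lam mu : ℂ)
    (hN : ∀ φ : Fock (Orb (FermionTorus 2 L)), IsGroundStateInSector (hubbardTorus 2 L 1 U) N 0 φ →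
      ((fockD4 (L := L) γ).val * (fockTranslate v).val) *ᵥ φ = lam • φ)
    (hN2 : ∀ χ : Fock (Orb (FermionTorus 2 L)), IsGroundStateInSector (hubbardTorus 2 L 1 U) (N - 2) 0 χ →
      ((fockD4 (L := L) γ).val * (fockTranslate v).val) *ᵥ χ = mu • χ)
    (hne : mu ≠ b1gChar γ * lam) {a' : ℝ} (ha' : 0 < a') (φ χ : Fock (Orb (FermionTorus 2 L)))
    (hφ : IsGroundStateInSector (hubbardTorus 2 L 1 U) N 0 φ)
    (hχ : IsGroundStateInSector (hubbardTorus 2 L 1 U) (N - 2) 0 χ) (hχ1 : star χ ⬝ᵥ χ = 1) :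
    ¬ a' * (L : ℝ) ^ 4 ≤ ‖star χ ⬝ᵥ Matrix.mulVec (pairField dWaveFormFactor L) φ‖ ^ 2 := by
  have hz : star χ ⬝ᵥ (pairField dWaveFormFactor L *ᵥ φ) = 0 :=
    pairField_dWave_matrixElement_eq_zero γ v lam mu φ χ (hN φ hφ) (hN2 χ hχ) hχ1 hne
  intro hle
  rw [hz, norm_zero] at hle
  have hLpos : (0 : ℝ) < (L : ℝ) := by exact_mod_cast Nat.pos_of_ne_zero (NeZero.ne L)
  have : 0 < a' * (L : ℝ) ^ 4 := by positivity
  have h0 : a' * (L : ℝ) ^ 4 ≤ 0 := by simpa using hle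
  linarith

/-- **THE NEGATIVE LEMMA: zero-excess pair order at a point with floor mismatch infinitely often refutes `JmInterchange`.**
H supplies `(U, δ)` with zero-excess pair order; the crux in single-layer form (`jmInterchange_iff_singleLayerForm`)
supplies `a' > 0`, `L₀` and, for every even `L ≥ L₀`, a unit floor pair `(φ, χ)` with `a' L⁴ ≤ |⟨χ, Δ_d φ⟩|²`; H
supplies a mismatched even `L ≥ L₀`, where `no_floorPair_of_mismatch` forbids such a pair. [folklore] -/
theorem JmInterchange_false_of_ZepoFloorMismatch (hH : ZepoFloorMismatch) : ¬ JmInterchange := by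
  intro hJ
  obtain ⟨U, hU, δ, hδ, hZ, hM⟩ := hH
  obtain ⟨a', ha', L₀, hbr⟩ := (jmInterchange_iff_singleLayerForm.mp hJ) U δ hU hδ hZ
  obtain ⟨L, hLnz, hE, hL₀L, γ, v, lam, mu, hVN, hVN2, hne⟩ := hM L₀
  obtain ⟨φ, χ, hφ, -, hχ, hχ1, hle⟩ := hbr L hE hL₀L
  exact no_floorPair_of_mismatch U _ γ v lam mu hVN hVN2 hne ha' φ χ hφ hχ hχ1 hle

/-- **Variant: an ordered floor with a mismatched adjacent floor infinitely often refutes `JmInterchange`.**  If at some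
`U > 0`, `δ ∈ (0, 1/2)` eventually some unit ground state `g` of `(N_L, 0)` has `‖Δ_d g‖² ≥ cL⁴` (FLOOR ORDER) while
the two adjacent floors mismatch in symmetry for infinitely many even `L`, the crux fails: a ground state has zero
excess (`zeroExcessPairOrder_of_floorOrder`), so this is `JmInterchange_false_of_ZepoFloorMismatch`.  This is the
(R2′)-type failure (tower collision by quantum numbers) of `jmInterchange_iff_reachesFloor_and_bridges`. [folklore] -/
theorem JmInterchange_false_of_floorOrder_of_floorMismatch (U δ : ℝ) (hU : 0 < U)
    (hδ : δ ∈ Set.Ioo (0 : ℝ) (1 / 2))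
    (hF : ∃ c : ℝ, 0 < c ∧ ∃ L₀ : ℕ, ∀ (L : ℕ) [NeZero L], Even L → L₀ ≤ L →
      ∃ g : Fock (Orb (FermionTorus 2 L)),
        IsGroundStateInSector (hubbardTorus 2 L 1 U) (2 * ⌊(1 - δ) * (L : ℝ) ^ 2 / 2⌋₊) 0 g ∧
        star g ⬝ᵥ g = 1 ∧
        c * (L : ℝ) ^ 4 ≤
          (star (pairField dWaveFormFactor L *ᵥ g) ⬝ᵥ (pairField dWaveFormFactor L *ᵥ g)).re)
    (hM : ∀ L₀ : ℕ, ∃ (L : ℕ) (_ : NeZero L), Even L ∧ L₀ ≤ L ∧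
      ∃ (γ : DihedralGroup 4) (v : TorusSite 2 L) (lam mu : ℂ),
        (∀ φ : Fock (Orb (FermionTorus 2 L)),
          IsGroundStateInSector (hubbardTorus 2 L 1 U) (2 * ⌊(1 - δ) * (L : ℝ) ^ 2 / 2⌋₊) 0 φ →
            ((fockD4 (L := L) γ).val * (fockTranslate v).val) *ᵥ φ = lam • φ) ∧
        (∀ χ : Fock (Orb (FermionTorus 2 L)),
          IsGroundStateInSector (hubbardTorus 2 L 1 U) (2 * ⌊(1 - δ) * (L : ℝ) ^ 2 / 2⌋₊ - 2) 0 χ →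
            ((fockD4 (L := L) γ).val * (fockTranslate v).val) *ᵥ χ = mu • χ) ∧
        mu ≠ b1gChar γ * lam) :
    ¬ JmInterchange :=
  JmInterchange_false_of_ZepoFloorMismatch ⟨U, hU, δ, hδ, zeroExcessPairOrder_of_floorOrder U δ hF, hM⟩

end Summit.HubbardSuperconductivity.JmInterchangeNegative

end
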